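import Summits.NavierStokesRegularity.NavierStokesRegularity.Theses.AxisymmetricExtremality
import Summits.NavierStokesRegularity.NavierStokesRegularity.Theorems.AxisymmetricExtremalityAxisymmetricKatoGlobalNoSwirlStratum
import Literature.Analysis.FluidPDE.AxisymmetricReflection

/-!
# Strategist s20 (family `s`) — typed census objects for the crux `AxisymmetricKatoGlobal`
(item stmt-NavierStokesRegularity-15453) of route-NavierStokesRegularity-AxisymmetricExtremality.

Kernel-checked facts recorded here (no `sorry`):

* § W1  `closes` consumes only the THRESHOLD instance `NoAxisymMinimalBlowup` of the crux
  (`closes_threshold`, `noAxisymMinimalBlowup_of_crux`).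
* § W2  The O(2)/dihedral bypass: if the Smith step is run with the dihedral groups (p-fold rotation
  + the meridional mirror `reflY`), the limiting minimal datum is axisymmetric AND mirror-equivariant,
  i.e. swirl-free (`IsAxisymmetric.hasNoSwirl_of_reflY_eq`), and the swirl-free stratum of the crux is
  ALREADY a tree theorem (`hasGlobalKatoSolution_of_isAxisymmetric_hasNoSwirl_viscosity`); so
  `MinimalDatumDihedral → DihedralToNoSwirl → NavierStokesRegularity` (`closes_O2`) with NO
  axisymmetric-with-swirl hypothesis at all; `MinimalDatumDihedral → MinimalDatumPFold`.
* § Summit-equivalence bookkeeping: over the tree, the one remaining open bet of either shape is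
  equivalent to the summit (`minimalDatumO2_iff_summit`, `minimalDatumDihedral_iff_summit_of`).
* § Decomposition (in-class threshold): `InClassThresholdAttained → NoInClassMinimalDatum →
  AxisymmetricKatoGlobal` (`crux_of_inClass_split`) and the converse (`inClass_split_of_crux`):
  the rigidity piece is the crux again modulo the (provable-technology) attainment piece.
* § Strengthen: the `L³`-only form `AxisymKatoGlobalL3 → AxisymmetricKatoGlobal`.
-/

noncomputable section

open MeasureTheory Set Function
open scoped ENNReal
open Literature.Analysis.FluidPDE
open Summit.NavierStokesRegularity.NavierStokesRegularity.Theses.AxisymmetricExtremality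
open Summit.NavierStokesRegularity.NavierStokesRegularity.Theorems.AxisymmetricKatoGlobal.NoSwirlStratum

namespace Summit.NavierStokesRegularity.NavierStokesRegularity.Cruxes.AxisymmetricKatoGlobal.StrategistS20

/-! ## The Clay-failure antecedent and the summit -/

/-- Clay (A) fails at viscosity `ν` (verbatim the antecedent of `MinimalDatumPFold`). -/
def ClayFailsAt (ν : ℝ) : Prop :=
  ∃ v₀ : EuclideanSpace ℝ (Fin 3) → EuclideanSpace ℝ (Fin 3), ContDiff ℝ (⊤ : ℕ∞) v₀ ∧
    Literature.Analysis.FluidPDE.NSWave0.IsDivFree v₀ ∧ Literature.Analysis.FluidPDE.HasRapidSpatialDecay v₀ ∧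
    ¬ ∃ (u : ℝ → EuclideanSpace ℝ (Fin 3) → EuclideanSpace ℝ (Fin 3)) (p : ℝ → EuclideanSpace ℝ (Fin 3) → ℝ),
      Literature.Analysis.FluidPDE.IsSmoothOnHalfSpace u ∧ Literature.Analysis.FluidPDE.IsSmoothOnHalfSpace p ∧
        Literature.Analysis.FluidPDE.IsNavierStokesSolution ν 0 v₀ u p ∧ Literature.Analysis.FluidPDE.HasBoundedEnergy u

/-- The summit is exactly "Clay (A) fails at no viscosity". -/
theorem summit_iff_not_clayFailsAt : _root_.NavierStokesRegularity ↔ ∀ ν : ℝ, 0 < ν → ¬ ClayFailsAt ν := by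
  constructor
  · rintro hS ν hν ⟨v₀, hsm, hdiv, hdec, hno⟩
    have hS' : Literature.NS.NavierStokesExistenceSmoothR3 := hS
    exact hno (hS' ν hν v₀ hsm hdiv hdec)
  · intro h
    show Literature.NS.NavierStokesExistenceSmoothR3
    intro ν hν u₀ hsm hdiv hdec
    by_contra hno
    exact h ν hν ⟨u₀, hsm, hdiv, hdec, hno⟩

/-! ## § W1 — the threshold instance is all that `closes` consumes -/

/-- THRESHOLD INSTANCE of the crux: there is no axisymmetric Rusin–Šverák minimal blow-up datum. -/
def NoAxisymMinimalBlowup : Prop :=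
  ∀ ν : ℝ, 0 < ν → ∀ (u₀ : EuclideanSpace ℝ (Fin 3) → EuclideanSpace ℝ (Fin 3))
    (g : Literature.Analysis.FunctionSpaces.HomSobolev (EuclideanSpace ℝ (Fin 3)) (EuclideanSpace ℂ (Fin 3)) (1 / 2 : ℝ)),
    IsMinimalBlowupDatum ν u₀ g → IsAxisymmetric u₀ → False

/-- The crux implies its threshold instance (trivial direction). -/
theorem noAxisymMinimalBlowup_of_crux (h : AxisymmetricKatoGlobal) : NoAxisymMinimalBlowup := by
  intro ν hν u₀ g hmin hax
  obtain ⟨hL3, hrep, hdiv, -, hnot⟩ := hmin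
  exact hnot (h ν hν u₀ g hL3 hrep hdiv (fun θ x => hax θ x))

/-- `closes` with the crux replaced by its threshold instance: same proof. -/
theorem closes_threshold (h₂ : MinimalDatumPFold) (h₄ : PFoldToAxisymmetric) (h₃ : NoAxisymMinimalBlowup) :
    _root_.NavierStokesRegularity := by
  show Literature.NS.NavierStokesExistenceSmoothR3
  intro ν hν u₀ hsm hdiv hdec
  by_contra hno
  obtain ⟨u₁, g, hmin, hax⟩ := h₄ ν hν (h₂ ν hν ⟨u₀, hsm, hdiv, hdec, hno⟩)
  exact h₃ ν hν u₁ g hmin (fun θ x => hax θ x)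

/-! ## § W2 — the O(2) / dihedral bypass: mirror-equivariance kills the swirl -/

/-- Equivariance under the meridional mirror `σ (x₀,x₁,x₂) = (x₀,−x₁,x₂)`: `u (σ x) = σ (u x)`. -/
def IsMirrorEquivariant (u₀ : EuclideanSpace ℝ (Fin 3) → EuclideanSpace ℝ (Fin 3)) : Prop :=
  ∀ x, u₀ (reflY x) = reflY (u₀ x)

/-- BET′ (replaces `MinimalDatumPFold`; the Smith step run with the dihedral groups `D_p ⊂ O(2)`, e.g. the
2-groups `D_{2^k}`): Clay failure at `ν` ⇒ for unboundedly many `p ≥ 2` there is a minimal blow-up datum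
equivariant under the rotation by `2π/p` about the `x₂`-axis AND under the meridional mirror. -/
def MinimalDatumDihedral : Prop :=
  ∀ ν : ℝ, 0 < ν → ClayFailsAt ν → ∀ N : ℕ, ∃ p : ℕ, N ≤ p ∧ 2 ≤ p ∧
    ∃ (u₀ : EuclideanSpace ℝ (Fin 3) → EuclideanSpace ℝ (Fin 3))
      (g : Literature.Analysis.FunctionSpaces.HomSobolev (EuclideanSpace ℝ (Fin 3)) (EuclideanSpace ℂ (Fin 3)) (1 / 2 : ℝ)),
      IsMinimalBlowupDatum ν u₀ g ∧ (∀ x, u₀ (rotZ (2 * Real.pi / p) x) = rotZ (2 * Real.pi / p) (u₀ x)) ∧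
        IsMirrorEquivariant u₀

/-- GLUE′ (the analogue of the PROVED `PFoldToAxisymmetric`, carrying the mirror through the same
modulation / `L³`-limit / axis-pinning / dense-angle argument): dihedral minimal data for unboundedly many `p`
⇒ an axisymmetric, mirror-equivariant minimal blow-up datum. -/
def DihedralToNoSwirl : Prop :=
  ∀ ν : ℝ, 0 < ν → (∀ N : ℕ, ∃ p : ℕ, N ≤ p ∧ 2 ≤ p ∧
    ∃ (u₀ : EuclideanSpace ℝ (Fin 3) → EuclideanSpace ℝ (Fin 3))
      (g : Literature.Analysis.FunctionSpaces.HomSobolev (EuclideanSpace ℝ (Fin 3)) (EuclideanSpace ℂ (Fin 3)) (1 / 2 : ℝ)),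
      IsMinimalBlowupDatum ν u₀ g ∧ (∀ x, u₀ (rotZ (2 * Real.pi / p) x) = rotZ (2 * Real.pi / p) (u₀ x)) ∧
        IsMirrorEquivariant u₀) →
    ∃ (u₀ : EuclideanSpace ℝ (Fin 3) → EuclideanSpace ℝ (Fin 3))
      (g : Literature.Analysis.FunctionSpaces.HomSobolev (EuclideanSpace ℝ (Fin 3)) (EuclideanSpace ℂ (Fin 3)) (1 / 2 : ℝ)),
      IsMinimalBlowupDatum ν u₀ g ∧ IsAxisymmetric u₀ ∧ IsMirrorEquivariant u₀

/-- BET″ (the `p`-free form; Smith theory for `O(2) = closure ⋃ D_{2^k}` on `M̂` via Čech continuity, plus the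
lift rigidity): Clay failure at `ν` ⇒ an `O(2)`-equivariant (axisymmetric + mirror) minimal blow-up datum. -/
def MinimalDatumO2 : Prop :=
  ∀ ν : ℝ, 0 < ν → ClayFailsAt ν →
    ∃ (u₀ : EuclideanSpace ℝ (Fin 3) → EuclideanSpace ℝ (Fin 3))
      (g : Literature.Analysis.FunctionSpaces.HomSobolev (EuclideanSpace ℝ (Fin 3)) (EuclideanSpace ℂ (Fin 3)) (1 / 2 : ℝ)),
      IsMinimalBlowupDatum ν u₀ g ∧ IsAxisymmetric u₀ ∧ IsMirrorEquivariant u₀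

/-- An axisymmetric mirror-equivariant minimal blow-up datum is absurd: it is swirl-free, and the swirl-free
stratum of the crux is a tree theorem. NO axisymmetric-with-swirl input. -/
theorem false_of_minimal_axisym_mirror {ν : ℝ} (hν : 0 < ν)
    {u₀ : EuclideanSpace ℝ (Fin 3) → EuclideanSpace ℝ (Fin 3)}
    {g : Literature.Analysis.FunctionSpaces.HomSobolev (EuclideanSpace ℝ (Fin 3)) (EuclideanSpace ℂ (Fin 3)) (1 / 2 : ℝ)}
    (hmin : IsMinimalBlowupDatum ν u₀ g) (hax : IsAxisymmetric u₀) (hσ : IsMirrorEquivariant u₀) : False := by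
  obtain ⟨hL3, -, hdiv, -, hnot⟩ := hmin
  exact hnot (hasGlobalKatoSolution_of_isAxisymmetric_hasNoSwirl_viscosity hν hL3 hdiv hax
    (hax.hasNoSwirl_of_reflY_eq hσ))

/-- `closes` of the modified route, O(2) form: ONE bet, no AX_H. -/
theorem closes_O2' (h : MinimalDatumO2) : _root_.NavierStokesRegularity := by
  rw [summit_iff_not_clayFailsAt]
  intro ν hν hfail
  obtain ⟨u₀, g, hmin, hax, hσ⟩ := h ν hν hfail
  exact false_of_minimal_axisym_mirror hν hmin hax hσ

/-- `closes` of the modified route, dihedral form: Smith bet (2-groups / dihedral) + compactness glue, no AX_H. -/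
theorem closes_O2 (h₂ : MinimalDatumDihedral) (h₄ : DihedralToNoSwirl) : _root_.NavierStokesRegularity := by
  rw [summit_iff_not_clayFailsAt]
  intro ν hν hfail
  obtain ⟨u₀, g, hmin, hax, hσ⟩ := h₄ ν hν (h₂ ν hν hfail)
  exact false_of_minimal_axisym_mirror hν hmin hax hσ

/-- The dihedral bet refines the route's p-fold bet. -/
theorem minimalDatumPFold_of_dihedral (h : MinimalDatumDihedral) : MinimalDatumPFold := by
  intro ν hν hfail N
  obtain ⟨p, hNp, h2p, u₀, g, hmin, hrot, -⟩ := h ν hν hfail N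
  exact ⟨p, hNp, h2p, u₀, g, hmin, fun x => hrot x⟩

/-- Dihedral bet + glue ⇒ the `O(2)` bet. -/
theorem minimalDatumO2_of_dihedral (h₂ : MinimalDatumDihedral) (h₄ : DihedralToNoSwirl) : MinimalDatumO2 :=
  fun ν hν hfail => h₄ ν hν (h₂ ν hν hfail)

/-! ## Summit-equivalence bookkeeping (said plainly: the one open bet of the bypassed route is the summit
over the tree, exactly as `MinimalDatumPFold` is the summit relative to AX_H + the proved glue). -/

theorem minimalDatumO2_iff_summit : MinimalDatumO2 ↔ _root_.NavierStokesRegularity := by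
  refine ⟨closes_O2', fun hS => ?_⟩
  rw [summit_iff_not_clayFailsAt] at hS
  exact fun ν hν hfail => (hS ν hν hfail).elim

theorem minimalDatumDihedral_iff_summit_of (h₄ : DihedralToNoSwirl) :
    MinimalDatumDihedral ↔ _root_.NavierStokesRegularity := by
  refine ⟨fun h₂ => closes_O2 h₂ h₄, fun hS => ?_⟩
  rw [summit_iff_not_clayFailsAt] at hS
  exact fun ν hν hfail => (hS ν hν hfail).elim

/-! ## § Decomposition — the in-class threshold split (Kenig–Merle shape inside the axisymmetric class) -/

/-- an axisymmetric critical blow-up datum at viscosity `ν` of `Ḣ^{1/2}`-size `ρ`. -/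
def IsAxisymBlowupDatumOfSize (ν : ℝ) (u₀ : EuclideanSpace ℝ (Fin 3) → EuclideanSpace ℝ (Fin 3))
    (g : Literature.Analysis.FunctionSpaces.HomSobolev (EuclideanSpace ℝ (Fin 3)) (EuclideanSpace ℂ (Fin 3)) (1 / 2 : ℝ))
    (ρ : ℝ≥0∞) : Prop :=
  MemLp u₀ 3 volume ∧ g.Represents (Literature.Analysis.FunctionSpaces.EuclideanSpace.complexify ∘ u₀) ∧
    IsWeaklyDivFree u₀ ∧ IsAxisymmetric u₀ ∧ ¬ HasGlobalKatoSolution ν u₀ ∧ ‖g‖ₑ = ρ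

/-- the in-class threshold `ρ_ax(ν)`: infimum of the sizes of axisymmetric blow-up data (`⊤` if none). -/
def rhoAx (ν : ℝ) : ℝ≥0∞ :=
  sInf {ρ | ∃ (u₀ : EuclideanSpace ℝ (Fin 3) → EuclideanSpace ℝ (Fin 3))
    (g : Literature.Analysis.FunctionSpaces.HomSobolev (EuclideanSpace ℝ (Fin 3)) (EuclideanSpace ℂ (Fin 3)) (1 / 2 : ℝ)),
    IsAxisymBlowupDatumOfSize ν u₀ g ρ}

/-- Sub_A (attainment / in-class profile decomposition; Rusin–Šverák / GKP / Jia–Šverák technology restricted to the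
closed, scaling- and axial-translation-invariant axisymmetric class): if axisymmetric blow-up data exist, one of
minimal size exists. -/
def InClassThresholdAttained : Prop :=
  ∀ ν : ℝ, 0 < ν → rhoAx ν < ⊤ →
    ∃ (u₀ : EuclideanSpace ℝ (Fin 3) → EuclideanSpace ℝ (Fin 3))
      (g : Literature.Analysis.FunctionSpaces.HomSobolev (EuclideanSpace ℝ (Fin 3)) (EuclideanSpace ℂ (Fin 3)) (1 / 2 : ℝ)),
      IsAxisymBlowupDatumOfSize ν u₀ g (rhoAx ν)

/-- Sub_B (rigidity: no in-class minimal blow-up datum). -/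
def NoInClassMinimalDatum : Prop :=
  ∀ ν : ℝ, 0 < ν → ∀ (u₀ : EuclideanSpace ℝ (Fin 3) → EuclideanSpace ℝ (Fin 3))
    (g : Literature.Analysis.FunctionSpaces.HomSobolev (EuclideanSpace ℝ (Fin 3)) (EuclideanSpace ℂ (Fin 3)) (1 / 2 : ℝ)),
    ¬ IsAxisymBlowupDatumOfSize ν u₀ g (rhoAx ν)

/-- Assembly of the split (proved): Sub_A → Sub_B → crux. -/
theorem crux_of_inClass_split (hA : InClassThresholdAttained) (hB : NoInClassMinimalDatum) :
    AxisymmetricKatoGlobal := by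
  intro ν hν u₀ g hL3 hrep hdiv hax
  by_contra hno
  have hmem : ‖g‖ₑ ∈ {ρ | ∃ (u₀ : EuclideanSpace ℝ (Fin 3) → EuclideanSpace ℝ (Fin 3))
      (g : Literature.Analysis.FunctionSpaces.HomSobolev (EuclideanSpace ℝ (Fin 3)) (EuclideanSpace ℂ (Fin 3)) (1 / 2 : ℝ)),
      IsAxisymBlowupDatumOfSize ν u₀ g ρ} :=
    ⟨u₀, g, hL3, hrep, hdiv, fun θ x => hax θ x, hno, rfl⟩
  have hlt : rhoAx ν < ⊤ := lt_of_le_of_lt (sInf_le hmem) enorm_lt_top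
  obtain ⟨u₁, g₁, h₁⟩ := hA ν hν hlt
  exact hB ν hν u₁ g₁ h₁

/-- Converse: the crux gives both pieces back (so the pair is exactly crux-strength, and Sub_B is the crux modulo
Sub_A). -/
theorem inClass_split_of_crux (h : AxisymmetricKatoGlobal) : InClassThresholdAttained ∧ NoInClassMinimalDatum := by
  have key : ∀ ν : ℝ, 0 < ν → ∀ (u₀ : EuclideanSpace ℝ (Fin 3) → EuclideanSpace ℝ (Fin 3))
      (g : Literature.Analysis.FunctionSpaces.HomSobolev (EuclideanSpace ℝ (Fin 3)) (EuclideanSpace ℂ (Fin 3)) (1 / 2 : ℝ))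
      (ρ : ℝ≥0∞), ¬ IsAxisymBlowupDatumOfSize ν u₀ g ρ := by
    rintro ν hν u₀ g ρ ⟨hL3, hrep, hdiv, hax, hno, -⟩
    exact hno (h ν hν u₀ g hL3 hrep hdiv (fun θ x => hax θ x))
  refine ⟨fun ν hν hlt => ?_, fun ν hν u₀ g => key ν hν u₀ g _⟩
  exfalso
  have hempty : {ρ | ∃ (u₀ : EuclideanSpace ℝ (Fin 3) → EuclideanSpace ℝ (Fin 3))
      (g : Literature.Analysis.FunctionSpaces.HomSobolev (EuclideanSpace ℝ (Fin 3)) (EuclideanSpace ℂ (Fin 3)) (1 / 2 : ℝ)),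
      IsAxisymBlowupDatumOfSize ν u₀ g ρ} = ∅ := by
    ext ρ
    simp only [mem_setOf_eq, mem_empty_iff_false, iff_false, not_exists]
    exact fun u₀ g => key ν hν u₀ g ρ
  have : rhoAx ν = ⊤ := by rw [rhoAx, hempty, sInf_empty]
  exact (lt_irrefl _) (this ▸ hlt)

/-! ## § Strengthen — the `L³`-only form (drop the `Ḣ^{1/2}` representative) -/

/-- S⁺: every axisymmetric weakly divergence-free `u₀ ∈ L³` has a global Kato solution (no `Ḣ^{1/2}` clause). -/
def AxisymKatoGlobalL3 : Prop :=
  ∀ ν : ℝ, 0 < ν → ∀ u₀ : EuclideanSpace ℝ (Fin 3) → EuclideanSpace ℝ (Fin 3),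
    MemLp u₀ 3 volume → IsWeaklyDivFree u₀ → IsAxisymmetric u₀ → HasGlobalKatoSolution ν u₀

theorem crux_of_L3 (h : AxisymKatoGlobalL3) : AxisymmetricKatoGlobal :=
  fun ν hν u₀ _g hL3 _hrep hdiv hax => h ν hν u₀ hL3 hdiv (fun θ x => hax θ x)

end Summit.NavierStokesRegularity.NavierStokesRegularity.Cruxes.AxisymmetricKatoGlobal.StrategistS20

end
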